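import Summits.AtomisticToContinuum.HydrodynamicLimit.Theorems.TwoClocksTransferEntropyClockTailRateCutoff
import Summits.AtomisticToContinuum.HydrodynamicLimit.Theorems.TwoClocksTransferEntropyClockTailRateKinetic
import Summits.AtomisticToContinuum.HydrodynamicLimit.Theorems.TwoClocksTransferEntropyClockTailRateCubic
import Summits.AtomisticToContinuum.HydrodynamicLimit.Theorems.OneFlightGossipEngineClampedTransferDockWindowClauseRate
import Summits.AtomisticToContinuum.HydrodynamicLimit.Theorems.OneFlightGossipEngineClampedTransferDockSeet
import Summits.AtomisticToContinuum.HydrodynamicLimit.Theses.UGibbsSRBRigidity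
import HarnessLib

/-!
# The one-window ledger at a rate from the TAIL-RATE inputs (stub `stub_tailRateWindowClause`, line `tail-rate`,
# crux `TwoClocks.TransferEntropyClock`, stmt-AtomisticToContinuum-16625)

Support file 4/4 (`--supports stmt-AtomisticToContinuum-16625`) proving the registered stub
`stub_tailRateWindowClause : TailRateWindowClause` (S_W′) of the lead's skeleton `Cruxes/TransferEntropyClock/Lines/tail_rate.lean`
(v2): the D-shape one-window entropy ledger of the shared heart — verbatim the conclusion of the landed
`ClampedTransferDockRate.WindowClauseRate` (crux 17615) — from the explicit kinetic family node `KineticLDExplicitFamily` (tilt radius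
`β₁/C`; the def is the verbatim copy of helper file 2/4), the local transfer family node, the two activity tails, the `N`-uniform
Gaussian velocity moments `UGibbsSRBRigidity.GaussianTails` (item stmt-14415) and ECT; `TailRateWindowClause` is re-declared verbatim
from the skeleton. QUANTIFIER PLUMBING over landed estimates with the cut-off at the TAIL level, NO band and NO coherence input: the
template `ClampedTransferDockRate.stub_windowClauseRate` (itself from `HydroLimitInBandHeart.stub_windowClause`) re-run with KC1 :=
`tailRate_explicitKineticInstance tailRate_cutoffQuant` (files 1–2/4: tilt `κ/(Cg K₁)`), the cubic channel := `tailRate_cubicTailWindow`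
(file 3/4) fed by `ClampedTransferDockSeet.lintegral_cubicTail_le_of_expMoment` on the Gaussian moments, and the rate bookkeeping of
file 3/4. Order of choices: thresholds `ηw`, `σ₀`; on `(0,t)`: slab bounds, `(κ, Cg)`, LC1 `(V, β₀C)`, Gaussian moments
`(c_G, C_G, N_G)`, freeze constant, `M₃`, `Cst`; for a target `δ`: `c′ := 10tCg/κ + 2 ↦ Cρ ↦ (C_T, A′, K₀) ↦ K₁ ↦ G_{K₁} ↦
β := min(κ/(Cg K₁), β₀C) ↦ (K := 5/β, S, ε)`, then `ε′ ↦ (ε₁, ε₃, τ, N₀)` and per window C0 + `stub_windowEstimateRate` + the a-priori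
bound. prover-line-stmt-AtomisticToContinuum-16625-c5-0 (stub worker `stub_tailRateWindowClause`).
-/

noncomputable section

open MeasureTheory Filter Set Topology InformationTheory
open scoped ENNReal

namespace Summit.AtomisticToContinuum.HydrodynamicLimit.Theorems.TransferEntropyClockTailRateWindowClause

open Literature.MathematicalPhysics.KineticTheory Literature.Analysis.FluidPDE Literature.Analysis.FunctionSpaces
open Summit.AtomisticToContinuum.HydrodynamicLimit.Theses
open Summit.AtomisticToContinuum.HydrodynamicLimit.Theorems
open Summit.AtomisticToContinuum.HydrodynamicLimit.Theorems.HydroLimitInBandOfHeart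
  (GronwallCoreInBand LocalClampedTransferWindowLDFamily CollisionEnergyActivityTails)
open Summit.AtomisticToContinuum.HydrodynamicLimit.Theorems.TransferEntropyClockTailRateKinetic (KineticLDExplicitFamily)
open Summit.AtomisticToContinuum.HydrodynamicLimit.Theorems.TransferEntropyClockTailRateCubic
  (tailRate_cubicTailWindow floor_budget rate_budget' ledger_step')
open Summit.AtomisticToContinuum.HydrodynamicLimit.Theorems.ClampedCurrentsDockCubicChannelPrelim (slab_package tendsto_window_zero)

/-! ## §1 The statement (verbatim from the registered skeleton `Cruxes/TransferEntropyClock/Lines/tail_rate.lean` §1) -/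

/-- registered stub signature `stub_tailRateWindowClause` (S_W′ target `TailRateWindowClause`) of line tail-rate, crux TransferEntropyClock
(stmt-AtomisticToContinuum-16625): the D-shape one-window entropy ledger of the shared heart from the tail-rate inputs (explicit kinetic
family node, local transfer family node, the two activity tails, the N-uniform Gaussian velocity moments `UGibbsSRBRigidity.GaussianTails`,
ECT); the conclusion is verbatim the conclusion of the landed `ClampedTransferDockRate.WindowClauseRate` — route-internal, not a cited fact -/
def TailRateWindowClause : Prop :=
  KineticLDExplicitFamily → LocalClampedTransferWindowLDFamily → CollisionEnergyActivityTails →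
    OneFlightGossipEngine.CollisionActivityTails → UGibbsSRBRigidity.GaussianTails → OneFlightGossipEngine.EnergyCurrentTails →
  ∀ (r : ℝ) (Rf : ℝ → ℝ), 0 < r →
    (∃ p : FormalMultilinearSeries ℝ ℝ ℝ, HasFPowerSeriesOnBall Rf p 0 (ENNReal.ofReal r)) →
    (∃ L : NNReal, LipschitzOnWith L Rf (Icc 0 r)) →
    (∀ x ∈ Ioo (-r) r, 0 < Rf x ∧ Rf x * (∑' j : ℕ, bE j / (j.factorial : ℝ) * (x * Rf x) ^ j) = 1) →
    (∀ x ∈ Icc 0 r, 1 ≤ Rf x ∧ Rf x ≤ 2) → ContinuousOn Rf (Icc 0 r) →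
    (∀ x ∈ Ioo (-r) r, ∀ R ∈ Icc (1 / 2 : ℝ) 2,
      R * (∑' j : ℕ, bE j / (j.factorial : ℝ) * (x * R) ^ j) = 1 → R = Rf x) →
    ∀ η₀ : ℝ, 0 < η₀ →
    (∀ (a θ₀ : T3 → ℝ) (u₀ : T3 → V3), Continuous a → Continuous θ₀ → Continuous u₀ → (∀ x, 0 < a x) →
      (∀ x, 0 < θ₀ x) → ∀ σ : ℝ, 0 < σ → σ ^ 3 * (⨆ x, a x) ≤ η₀ * ∫ x, a x →
      ∃ ρ₀ : T3 → ℝ, Continuous ρ₀ ∧ (∀ x, 0 < ρ₀ x) ∧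
        (∀ (N : ℕ) (Φ : HardSphereFlow (Torus.geometry (Fin 3)) (hsDiameter σ N) (N + 1)),
          IsProbabilityMeasure (localGibbsLaw σ a u₀ θ₀ N Φ)) ∧
        ∀ χ : T3 → ℝ, Continuous χ → ∀ δ : ℝ, 0 < δ → ∃ C : ℝ, 0 < C ∧
          ∀ (N : ℕ) (Φ : HardSphereFlow (Torus.geometry (Fin 3)) (hsDiameter σ N) (N + 1)),
            localGibbsLaw σ a u₀ θ₀ N Φ {z | δ < |empiricalDensityField z χ - ∫ x, χ x * ρ₀ x|} ≤
                ENNReal.ofReal (C * Real.exp (-(C⁻¹ * ((N : ℝ) + 1)))) ∧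
              localGibbsLaw σ a u₀ θ₀ N Φ
                  {z | δ < ‖empiricalMomentumField z χ - ∫ x, (χ x * ρ₀ x) • u₀ x‖} ≤
                ENNReal.ofReal (C * Real.exp (-(C⁻¹ * ((N : ℝ) + 1)))) ∧
              localGibbsLaw σ a u₀ θ₀ N Φ {z | δ < |empiricalEnergyField z χ -
                  ∫ x, χ x * totalEnergyDensity (ρ₀ x) (u₀ x) (θ₀ x)|} ≤
                ENNReal.ofReal (C * Real.exp (-(C⁻¹ * ((N : ℝ) + 1))))) →
    ∃ ηp : ℝ, 0 < ηp ∧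
    ∀ (a₀ θ₀ : T3 → ℝ) (u₀ : T3 → V3), Continuous a₀ → Continuous θ₀ → Continuous u₀ →
      (∀ x, 0 < a₀ x) → (∀ x, 0 < θ₀ x) →
      ∃ σ₀ : ℝ, 0 < σ₀ ∧ ∀ σ : ℝ, 0 < σ → σ < σ₀ →
        ∀ (T : ℝ) (ρ θ : ℝ → T3 → ℝ) (u : ℝ → T3 → V3), IsHardSphereEulerSolution σ T ρ u θ →
          (∀ s ∈ Set.Ico 0 T, ∀ x, ρ s x * σ ^ 3 < ηp) →
          ∀ Φ : (N : ℕ) → HardSphereFlow (Torus.geometry (Fin 3)) (hsDiameter σ N) (N + 1),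
            TendstoHydroFieldsAt (fun N => localGibbsLaw σ a₀ u₀ θ₀ N (Φ N)) Φ ρ u θ 0 →
            ∀ t ∈ Set.Ioo 0 T,
              ∃ Cst : ℝ → ℝ, ContinuousOn Cst (Set.Icc 0 t) ∧
                (∀ ε : ℝ, 0 < ε → ∃ N₀ : ℕ, ∀ N : ℕ, N₀ ≤ N → ∀ t' ∈ Set.Icc 0 t,
                  |Real.log (posPartition (fun x => ρ t' x * Rf (σ ^ 3 * ρ t' x)) (hsDiameter σ N) (N + 1)) -
                      Real.log (posPartition (fun x => ρ 0 x * Rf (σ ^ 3 * ρ 0 x)) (hsDiameter σ N) (N + 1)) +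
                    ((N : ℝ) + 1) * ∫ r in (0 : ℝ)..t', Cst r| ≤ ((N : ℝ) + 1) * ε) ∧
                ∀ δ : ℝ, 0 < δ → ∃ K : ℝ, 0 ≤ K ∧ ∃ ε : ℝ, 0 < ε ∧ 4 * (1 + t) * ε * Real.exp (2 * K * t) ≤ δ ∧
                ∃ τ : ℝ, 0 < τ ∧ ∃ N₀ : ℕ, ∀ N : ℕ, N₀ ≤ N →
                ∀ s : ℝ, 0 ≤ s → s + τ * ((N : ℝ) + 1) ^ (-(1 / 3 : ℝ)) ≤ t →
                (klDiv ((Φ N).lawAt (localGibbsLaw σ a₀ u₀ θ₀ N (Φ N)) (s + τ * ((N : ℝ) + 1) ^ (-(1 / 3 : ℝ))))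
                  (localGibbsLaw σ (fun x => ρ (s + τ * ((N : ℝ) + 1) ^ (-(1 / 3 : ℝ))) x *
                      Rf (σ ^ 3 * ρ (s + τ * ((N : ℝ) + 1) ^ (-(1 / 3 : ℝ))) x))
                    (u (s + τ * ((N : ℝ) + 1) ^ (-(1 / 3 : ℝ)))) (θ (s + τ * ((N : ℝ) + 1) ^ (-(1 / 3 : ℝ))))
                    N (Φ N))).toReal ≤
                (klDiv ((Φ N).lawAt (localGibbsLaw σ a₀ u₀ θ₀ N (Φ N)) s)
                  (localGibbsLaw σ (fun x => ρ s x * Rf (σ ^ 3 * ρ s x)) (u s) (θ s) N (Φ N))).toReal +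
                K * (τ * ((N : ℝ) + 1) ^ (-(1 / 3 : ℝ))) *
                  sSup ((fun s' => (klDiv ((Φ N).lawAt (localGibbsLaw σ a₀ u₀ θ₀ N (Φ N)) s')
                    (localGibbsLaw σ (fun x => ρ s' x * Rf (σ ^ 3 * ρ s' x)) (u s') (θ s') N (Φ N))).toReal) ''
                    Set.Icc 0 (s + τ * ((N : ℝ) + 1) ^ (-(1 / 3 : ℝ)))) +
                (τ * ((N : ℝ) + 1) ^ (-(1 / 3 : ℝ))) * ((N : ℝ) + 1) * ε +
                ((Real.log (posPartition (fun x => ρ (s + τ * ((N : ℝ) + 1) ^ (-(1 / 3 : ℝ))) x *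
                      Rf (σ ^ 3 * ρ (s + τ * ((N : ℝ) + 1) ^ (-(1 / 3 : ℝ))) x)) (hsDiameter σ N) (N + 1)) -
                    Real.log (posPartition (fun x => ρ s x * Rf (σ ^ 3 * ρ s x)) (hsDiameter σ N) (N + 1))) +
                  (τ * ((N : ℝ) + 1) ^ (-(1 / 3 : ℝ))) * ((N : ℝ) + 1) * Cst s)

/-! ## §2 The stub -/

set_option maxHeartbeats 400000 in -- one declaration: the whole threshold bookkeeping of the one-window ledger (as the template)
/-- **STUB `stub_tailRateWindowClause : TailRateWindowClause` — Yau's one-window entropy ledger at a rate, D-shape, with the cut-off at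
the TAIL level** (line `tail-rate`, crux `TransferEntropyClock`, stmt-AtomisticToContinuum-16625): the template
`ClampedTransferDockRate.stub_windowClauseRate` re-run with the EXPLICIT kinetic node (`explicitKineticInstance`: tilt `κ/(Cg K₁)`) and an
EMPTY band — the cubic channel is paid by the Gaussian velocity tails of `UGibbsSRBRigidity.GaussianTails` alone (`cubic_tail_window`,
`ClampedTransferDockSeet.lintegral_cubicTail_le_of_expMoment`). Order of choices: thresholds `ηw`, `σ₀`; on `(0,t)`: slab bounds, `(κ, Cg)`,
LC1 `(V, β₀C)`, Gaussian moments `(c_G, C_G, N_G)`, freeze constant, `M₃`, `Cst`; for a target `δ`: `c′ := 10tCg/κ + 2 ↦ Cρ ↦ (C_T, A′, K₀) ↦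
K₁ ↦ G_{K₁} ↦ β := min(κ/(Cg K₁), β₀C) ↦ (K := 5/β, S, ε)`, then `ε′ ↦ (ε₁, ε₃, τ, N₀)` and per window C0 + `stub_windowEstimateRate` + the
a-priori bound. Adapted from `ClampedTransferDockRate.stub_windowClauseRate` (itself from `HydroLimitInBandHeart.stub_windowClause`).
[cite: Yau1991, §2; OllaVaradhanYau1993, §3] -/
theorem stub_tailRateWindowClause : TailRateWindowClause := by
  intro hKE hLC hCEAT hCAT hGT hECT r Rf hr hana hLip hsol hbd hcont huniq η₀ hη₀ _HU
  -- adapted from `ClampedTransferDockRate.stub_windowClauseRate` (17615) and `HydroLimitInBandHeart.stub_windowClause` (9133-c3)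
  have hWE : ClampedTransferDockRate.WindowEstimateRate := ClampedTransferDockRate.stub_windowEstimateRate
  obtain ⟨η₁, hη₁, _hη₁r, F, hF, hZF, hRfF⟩ := ClampedCurrentsDockHeart.eosBridge hr hsol hbd hcont huniq
  obtain ⟨ηK, hηK, HK⟩ := TransferEntropyClockTailRateKinetic.tailRate_explicitKineticInstance
    TransferEntropyClockTailRateCutoff.tailRate_cutoffQuant hKE
  obtain ⟨ηC, hηC, HC⟩ := ClampedCurrentsDockLocalInstance.stub_localCollisionalInstance hLC
  obtain ⟨ηs, hηs, HS⟩ := ClampedCurrentsDockStaticLimit.stub_staticLimit r Rf hr hana hLip hsol hbd hcont huniq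
  obtain ⟨ηsc, hηsc, HSC⟩ := HydroLimitInBandHeart.stub_staticClause r Rf hr hana hLip hsol hbd hcont huniq
  set ηA : ℝ := min (r / (2 * (2 * (2 * Real.exp 1 + 1)))) (1 / (64 * Real.exp 1 * v₁)) with hηA
  have hηA0 : 0 < ηA := by have := v₁_pos; have := Real.exp_pos 1; positivity
  set ηw : ℝ := min (min (min (η₁ / 2) (min (ηK / 2) (ηC / 2))) (min ηs ηA)) ηsc with hηw
  have hηw0 : 0 < ηw := by positivity
  have hηw1 : ηw ≤ η₁ / 2 := (min_le_left _ _).trans ((min_le_left _ _).trans (min_le_left _ _))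
  have hηwK : ηw ≤ ηK / 2 := (min_le_left _ _).trans ((min_le_left _ _).trans ((min_le_right _ _).trans (min_le_left _ _)))
  have hηwC : ηw ≤ ηC / 2 := (min_le_left _ _).trans ((min_le_left _ _).trans ((min_le_right _ _).trans (min_le_right _ _)))
  have hηws : ηw ≤ ηs := (min_le_left _ _).trans ((min_le_right _ _).trans (min_le_left _ _))
  have hηwA : ηw ≤ ηA := (min_le_left _ _).trans ((min_le_right _ _).trans (min_le_right _ _))
  have hηwsc : ηw ≤ ηsc := min_le_right _ _
  have hηwr : ηw ≤ r := by
    have : ηA ≤ r / (2 * (2 * (2 * Real.exp 1 + 1))) := min_le_left _ _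
    have h2 : r / (2 * (2 * (2 * Real.exp 1 + 1))) ≤ r := by rw [div_le_iff₀ (by positivity)]; nlinarith [Real.exp_pos 1]
    linarith
  refine ⟨ηw, hηw0, fun a₀ θ₀ u₀ ha hθ hu ha0 hθ0 => ?_⟩
  obtain ⟨σG, hσG, HG⟩ := hGT a₀ θ₀ u₀ ha hθ hu ha0 hθ0
  obtain ⟨σT, hσT, HT⟩ := ClampedCurrentsDockTransferTails.stub_transferActivityTails hCAT hCEAT a₀ θ₀ u₀ ha hθ hu ha0 hθ0
  obtain ⟨σE, hσE, HE⟩ := hECT a₀ θ₀ u₀ ha hθ hu ha0 hθ0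
  refine ⟨min (min σG σT) (min σE (1 / 2)), lt_min (lt_min hσG hσT) (lt_min hσE (by norm_num)),
    fun σ hσ hσlt T ρ θ u hE hguard Φ htie t ht => ?_⟩
  have hσG' : σ < σG := hσlt.trans_le ((min_le_left _ _).trans (min_le_left _ _))
  have hσT' : σ < σT := hσlt.trans_le ((min_le_left _ _).trans (min_le_right _ _))
  have hσE' : σ < σE := hσlt.trans_le ((min_le_right _ _).trans (min_le_left _ _))
  have hσ2 : σ < 1 / 2 := hσlt.trans_le ((min_le_right _ _).trans (min_le_right _ _))
  have hσ3 : 0 < σ ^ 3 := pow_pos hσ 3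
  have ht0 : 0 < t := ht.1
  have htI : t ∈ Ico 0 T := ⟨ht.1.le, ht.2⟩
  have hIt : Icc 0 t ⊆ Ico 0 T := fun s hs => ⟨hs.1, hs.2.trans_lt ht.2⟩
  have hmass : ∀ s ∈ Ico 0 T, ∫ x, ρ s x = 1 := fun s hs => (DenseExcursionEverywhere.integral_density_eq hE hs).trans
    (DenseExcursionEverywhere.integral_density_zero_eq_one hσ2.le ha hθ hu ha0 hθ0 Φ htie)
  have hgs : ∀ s ∈ Ico 0 T, ∀ x, ρ s x * σ ^ 3 < ηs := fun s hs x => (hguard s hs x).trans_le hηws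
  have hgsc : ∀ s ∈ Ico 0 T, ∀ x, ρ s x * σ ^ 3 < ηsc := fun s hs x => (hguard s hs x).trans_le hηwsc
  have hg1 : ∀ s ∈ Ico 0 T, ∀ x, ρ s x * σ ^ 3 ∈ Ioo 0 η₁ := fun s hs x =>
    ⟨mul_pos (hE.density_pos s hs x) hσ3, (hguard s hs x).trans_le (hηw1.trans (by linarith))⟩
  have hg12 : ∀ s ∈ Icc 0 t, ∀ x, ρ s x * σ ^ 3 < η₁ / 2 := fun s hs x => (hguard s (hIt hs) x).trans_le hηw1
  have hgr : ∀ s ∈ Icc 0 t, ∀ x, ρ s x * σ ^ 3 < r := fun s hs x => (hguard s (hIt hs) x).trans_le hηwr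
  -- the explicit reference family: smooth and positive on `[0,T)` (SC-b)
  obtain ⟨hasm, hapos, -, -, -, -⟩ := HS σ hσ hσ2 T ρ θ u hE hgs hmass Φ t ht
  have hasm' : Torus.IsSmoothSpaceTimeOn (Ico 0 T) (fun s x => ρ s x * Rf (σ ^ 3 * ρ s x)) := hasm
  have hapos' : ∀ s ∈ Ico 0 T, ∀ x, 0 < (fun s x => ρ s x * Rf (σ ^ 3 * ρ s x)) s x := hapos
  have hac : ∀ s ∈ Ico 0 T, Continuous fun x => ρ s x * Rf (σ ^ 3 * ρ s x) := fun s hs => (hasm'.isSmooth_slice hs).continuous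
  have hρc : ∀ s ∈ Ico 0 T, Continuous (ρ s) := fun s hs => (hE.smooth_density.isSmooth_slice hs).continuous
  -- the guards of KC1 / LC1 along the family
  have hguardX : ∀ {ηX : ℝ}, 2 * ηw ≤ ηX → ∀ s ∈ Icc 0 t,
      σ ^ 3 * (⨆ x, ρ s x * Rf (σ ^ 3 * ρ s x)) ≤ ηX * ∫ x, ρ s x * Rf (σ ^ 3 * ρ s x) :=
    fun hX s hs => ClampedTransferDockCubicRate.guard_of_band_min hbd hσ (hE.density_pos s (hIt hs)) (hmass s (hIt hs))
      (fun x => (hguard s (hIt hs) x).trans_le (le_min (by linarith) hηwr)) (hρc s (hIt hs)) (hac s (hIt hs))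
  have hguardK : ∀ s ∈ Icc 0 t, σ ^ 3 * (⨆ x, (fun s x => ρ s x * Rf (σ ^ 3 * ρ s x)) s x) ≤
      ηK * ∫ x, (fun s x => ρ s x * Rf (σ ^ 3 * ρ s x)) s x := hguardX (by linarith)
  have hguardC : ∀ s ∈ Icc 0 t, σ ^ 3 * (⨆ x, ρ s x * Rf (σ ^ 3 * ρ s x)) ≤ ηC * ∫ x, ρ s x * Rf (σ ^ 3 * ρ s x) :=
    hguardX (by linarith)
  -- the slab package of the Euler solution on `[0, t]` (for the cubic channel)
  obtain ⟨θM', U', Bb', Lb', hθM', hU', hBb', -, hslab⟩ := slab_package hE htI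
  -- KC1 with the explicit tilt law along the solution on the slab `[0,t]`: `κ`, `Cg` before the level
  have hθsmI : Torus.IsSmoothSpaceTimeOn (Icc 0 t) θ := hE.smooth_temperature.mono hIt
  have husmI : Torus.IsSmoothSpaceTimeOn (Icc 0 t) u := hE.smooth_velocity.mono hIt
  have haconI : ContinuousOn (Function.uncurry fun s x => ρ s x * Rf (σ ^ 3 * ρ s x)) (Icc 0 t ×ˢ univ) :=
    (ClampedCurrentsDockHeart.continuousOn_uncurry_of_isSmoothSpaceTimeOn hasm').mono (prod_mono hIt subset_rfl)
  obtain ⟨κ, hκ, Cg, hCg, HKA⟩ := HK t (fun s x => ρ s x * Rf (σ ^ 3 * ρ s x)) θ u ht.1.le haconI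
    (fun s hs => hapos' s (hIt hs)) hθsmI husmI (fun s hs => hE.temperature_pos s (hIt hs)) σ hσ hguardK Φ
  -- LC1 along the CLAMPED families (globally continuous), read on the slab
  set cl : ℝ → ℝ := ClampedCurrentsDockHeart.clampTime t with hcl_def
  have hclm : ∀ s, cl s ∈ Icc 0 t := fun s => ClampedCurrentsDockHeart.clampTime_mem ht.1.le s
  have hclI : ∀ s, cl s ∈ Ico 0 T := fun s => hIt (hclm s)
  set ac : ℝ → T3 → ℝ := fun s x => ρ (cl s) x * Rf (σ ^ 3 * ρ (cl s) x) with hac_def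
  set θc : ℝ → T3 → ℝ := fun s => θ (cl s) with hθc_def
  set uc : ℝ → T3 → V3 := fun s => u (cl s) with huc_def
  have hacc : ∀ s, Continuous (ac s) := fun s => hac _ (hclI s)
  have hac0 : ∀ s x, 0 < ac s x := fun s x => hapos' _ (hclI s) x
  have hθc0 : ∀ s x, 0 < θc s x := fun s x => hE.temperature_pos _ (hclI s) x
  have hacu : Continuous (Function.uncurry ac) := ClampedCurrentsDockHeart.continuous_uncurry_clamp ht.1.le haconI
  have hθcu : Continuous (Function.uncurry θc) := ClampedCurrentsDockHeart.continuous_uncurry_clamp ht.1.le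
    ((ClampedCurrentsDockHeart.continuousOn_uncurry_of_isSmoothSpaceTimeOn hE.smooth_temperature).mono (prod_mono hIt subset_rfl))
  have hucu : Continuous (Function.uncurry uc) := ClampedCurrentsDockHeart.continuous_uncurry_clamp ht.1.le
    ((ClampedCurrentsDockHeart.continuousOn_uncurry_of_isSmoothSpaceTimeOn hE.smooth_velocity).mono (prod_mono hIt subset_rfl))
  have hcl_id : ∀ s ∈ Icc 0 t, cl s = s := fun s hs => ClampedCurrentsDockHeart.clampTime_of_mem hs
  have hθcsm : Torus.IsSmoothSpaceTimeOn (Icc 0 t) θc :=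
    ClampedCurrentsDockHeart.isSmoothSpaceTimeOn_congr hθsmI fun s hs => by simp only [hθc_def, hcl_id s hs]
  have hucsm : Torus.IsSmoothSpaceTimeOn (Icc 0 t) uc :=
    ClampedCurrentsDockHeart.isSmoothSpaceTimeOn_congr husmI fun s hs => by simp only [huc_def, hcl_id s hs]
  have hguardCc : ∀ s ∈ Icc 0 t, σ ^ 3 * (⨆ x, ac s x) ≤ ηC * ∫ x, ac s x := fun s hs => by
    simp only [hac_def, hcl_id s hs]
    exact hguardC s hs
  obtain ⟨V₀C, _hV₀C, HCV⟩ := HC t ac θc uc hacc hacu hθcu hucu hac0 hθc0 hθcsm hucsm σ hσ hσ2 hguardCc Φ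
  -- CC3: transfer-activity tails
  obtain ⟨V₀T, hV₀T, HTV⟩ := HT σ hσ hσT' T ρ θ u hE Φ htie t htI
  set V : ℝ := max V₀C V₀T with hV
  have hV0 : 0 ≤ V := hV₀T.le.trans (le_max_right _ _)
  obtain ⟨β₀C, hβ₀C, HCβ⟩ := HCV V (le_max_left _ _)
  -- the N-uniform Gaussian velocity moments along the true evolution (item stmt-14415), on `[0,t]`
  obtain ⟨cG, hcG, CGm, hCGm, NG, HGN⟩ := HG σ hσ hσG' T ρ θ u hE Φ htie t htI
  -- FZ: the freeze constant (also the common Lipschitz constant of the test functions)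
  obtain ⟨Cfz, hCfz0, HFZ⟩ := ClampedCurrentsDockFlowShiftFreeze.freezeBounds σ T ρ θ u η₁ F hE hσ hη₁ hF hZF t ht hg12
  -- ECT at accuracy one: the third-moment level
  obtain ⟨M₃, N₀E, HEN⟩ := HE σ hσ hσE' T ρ θ u hE Φ htie t htI 1 one_pos
  -- the static clause: `Cst` and the statics
  obtain ⟨hCst, hstat⟩ := HSC a₀ θ₀ u₀ ha hθ hu ha0 hθ0 σ hσ hσ2 T ρ θ u hE hgsc Φ htie t ht
  refine ⟨_, hCst, hstat, fun δ hδ => ?_⟩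
  -- THE RATE BOOKKEEPING FOR THE TARGET `δ`: `c′ ↦ Cρ ↦ (C_T, A′, K₀) ↦ K₁ ↦ G ↦ β ↦ (K, S, ε)`
  set c' : ℝ := 10 * t * Cg / κ + 2 with hc'
  have hc'0 : 0 < c' := by positivity
  obtain ⟨Cρ, hCρ0, HKK⟩ := HKA c' hc'0
  set CT : ℝ := 8 * Bb' * (1 + 5 * θM' + Cρ) with hCT
  have hCT0 : 0 ≤ CT := by positivity
  set A' : ℝ := (CT * Real.exp (c' * U') + Bb' * Cρ) * Real.exp (10 * t / β₀C) with hA'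
  set K₀T : ℝ := max (max 1 (48 / cG ^ 3)) (max (2 * (c' + 1) / cG) (CGm.toReal + 1)) with hK₀T
  obtain ⟨K₁, hK₁, hK₁b⟩ := ClampedTransferDockRate.exists_level_exp_small (max (K₀T + U') (max (2 * U') 1))
    (4 * (1 + t) * A') (δ / 2) (half_pos hδ)
  have hK₁T : K₀T ≤ K₁ - U' := le_sub_iff_add_le.2 ((le_max_left (K₀T + U') (max (2 * U') 1)).trans hK₁)
  have h2U : 2 * U' ≤ K₁ := ((le_max_left _ _).trans (le_max_right _ _)).trans hK₁
  have hK₁1 : (1 : ℝ) ≤ K₁ := ((le_max_right _ _).trans (le_max_right _ _)).trans hK₁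
  have hK₁0 : 0 ≤ K₁ := zero_le_one.trans hK₁1
  -- the quantitative cut-off `G = G_{K₁}` and the kinetic LD at tilts `|β| ≤ κ/(Cg K₁)`
  obtain ⟨G, hGc, ⟨CG, hCG⟩, hRem1, hRem2, HKβ⟩ := HKK K₁ hK₁1
  set CG' : ℝ := max CG 0 with hCG'
  have hCG'b : ∀ s ∈ Icc 0 t, ∀ y : T3 × ℝ, 0 ≤ y.2 → |G s y| ≤ CG' := fun s hs y hy => (hCG s hs y hy).trans (le_max_left _ _)
  -- the tilt
  set β : ℝ := min (κ / (Cg * K₁)) β₀C with hβ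
  have hβ0 : 0 < β := lt_min (by positivity) hβ₀C
  have hβK : |(-β)| ≤ κ / (Cg * K₁) := by rw [abs_neg, abs_of_pos hβ0]; exact min_le_left _ _
  have hβC : |(-β)| ≤ β₀C := by rw [abs_neg, abs_of_pos hβ0]; exact min_le_right _ _
  -- the floor `S`, the accuracy `ε₀`, the rate `K := 5/β`
  set S : ℝ := CT * Real.exp (-(c' * (K₁ - U'))) + Bb' * K₁ * (Cρ * Real.exp (-(c' * K₁))) with hS
  have hS0 : 0 ≤ S := by positivity
  set ε₀ : ℝ := δ * Real.exp (-(2 * (5 / β) * t)) / (8 * (1 + t)) with hε₀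
  have hε₀0 : 0 < ε₀ := by positivity
  have hfloor : S * Real.exp (2 * (5 / β) * t) ≤ A' * Real.exp (-K₁) :=
    floor_budget hCT0 hBb' hCρ0 hK₁1 ht0.le hκ hCg hβ₀C hβ
  refine ⟨5 / β, by positivity, ε₀ + S, by positivity, rate_budget' ht0 hfloor hK₁b, ?_⟩
  set ε' : ℝ := min ε₀ 1 with hε'
  have hε'0 : 0 < ε' := lt_min hε₀0 one_pos
  have hε'1 : ε' ≤ 1 := min_le_right _ _
  have hε'ε : ε' ≤ ε₀ := min_le_left _ _
  set ε₁ : ℝ := β * ε' / 10 with hε₁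
  have hε₁0 : 0 < ε₁ := by positivity
  set ε₃ : ℝ := ε' / (40 * (Cfz + 1)) with hε₃
  have hε₃0 : 0 < ε₃ := by positivity
  -- the window parameter `τ`
  obtain ⟨τK, hτK, HKτ⟩ := HKβ (-β) hβK ε₁ hε₁0
  obtain ⟨τC, _hτC, HCτ⟩ := HCβ (-β) hβC (ε₁ / 4) (by positivity)
  obtain ⟨τT, _hτT, HTτ⟩ := HTV V (le_max_right _ _) ε₃ hε₃0
  set τ : ℝ := max (max τK τC) τT with hτ_def
  have hτ0 : 0 < τ := hτK.trans_le ((le_max_left _ _).trans (le_max_left _ _))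
  obtain ⟨NK, HKN⟩ := HKτ τ ((le_max_left _ _).trans (le_max_left _ _))
  obtain ⟨NC, HCN⟩ := HCτ τ ((le_max_right _ _).trans (le_max_left _ _))
  obtain ⟨NT, HTN⟩ := HTτ τ (le_max_right _ _)
  -- `N` large enough for the freeze errors
  obtain ⟨Nsm, Hsm⟩ := eventually_atTop.1 ((tendsto_window_zero
    (Cfz * τ * (40 * (2 * (max M₃ 0) ^ 3 + 6 + V)))).eventually (Iic_mem_nhds hε'0))
  refine ⟨τ, hτ0, max (max (max NK NC) (max NG NT)) (max N₀E Nsm), fun N hN s hs0 hsw => ?_⟩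
  simp only [max_le_iff] at hN
  obtain ⟨⟨⟨hNK, hNC⟩, hNG, hNT⟩, hNE, hNsm⟩ := hN
  -- the window
  set w : ℝ := τ * ((N : ℝ) + 1) ^ (-(1 / 3 : ℝ)) with hw_def
  have hw0 : 0 < w := mul_pos hτ0 (Real.rpow_pos_of_pos (by positivity) _)
  have hsw' : s ≤ s + w := le_add_of_nonneg_right hw0.le
  have hsI : s ∈ Icc 0 t := ⟨hs0, hsw'.trans hsw⟩
  have hsT : s ∈ Ico 0 T := hIt hsI
  have hswT : s + w < T := hsw.trans_lt ht.2
  have hρsc : Continuous (ρ s) := hρc s hsT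
  have hρs0 : ∀ x, 0 < ρ s x := hE.density_pos s hsT
  -- C0: the one-window balance (identity + integrability)
  obtain ⟨hStrI, hColI, hbal⟩ := ClampedCurrentsDockWindowBalance.stub_windowBalance σ T N (Φ N) a₀ θ₀ u₀
    (fun s x => ρ s x * Rf (σ ^ 3 * ρ s x)) θ u hσ hσ2 ha hθ hu ha0 hθ0 hasm' hE.smooth_temperature hE.smooth_velocity hapos'
    hE.temperature_pos s w hs0 hw0.le hswT
  -- KC1 at `(N, s)`
  have hKs := HKN N hNK s hsI
  -- LC1 at `(N, s)`: read at the solution's fields and at `ρ₀ = ρ_s` (activity inversion)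
  have hcls : cl s = s := hcl_id s hsI
  have hpackA : σ ^ 3 * (⨆ x, ρ s x) ≤ min (r / (2 * (2 * (2 * Real.exp 1 + 1)))) (1 / (64 * Real.exp 1 * v₁)) := by
    have hbdd : BddAbove (Set.range (ρ s)) := (isCompact_range hρsc).bddAbove
    obtain ⟨xM, -, hxM⟩ := isCompact_univ.exists_isMaxOn univ_nonempty hρsc.continuousOn
    have hsup : (⨆ x, ρ s x) = ρ s xM :=
      le_antisymm (ciSup_le fun x => (isMaxOn_iff.mp hxM) x (mem_univ x)) (le_ciSup hbdd xM)
    rw [hsup, mul_comm]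
    exact ((hguard s hsT xM).trans_le hηwA).le
  have key : ∀ (f : T3 → ℝ) (hf : Continuous f) (hf0 : ∀ x, 0 < f x), f = (fun x => ρ s x * Rf (σ ^ 3 * ρ s x)) →
      rhoLim (profileOf f hf hf0) σ = ρ s := by
    rintro f hf hf0 rfl
    obtain ⟨_, _, -, -, h⟩ := EntropyClockDock.activity_of_density hr hsol hbd hcont huniq hσ hσ2 hρsc hρs0 (hmass s hsT) hpackA
    exact h
  have hρ₀ : rhoLim (profileOf (ac s) (hacc s) (hac0 s)) σ = ρ s :=
    key (ac s) (hacc s) (hac0 s) (by simp only [hac_def, hcls])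
  obtain ⟨hCm', hCe'⟩ := HCN N hNC s hsI
  have hCm := fun k : Fin 3 => hCm' k
  have hCe := hCe'
  simp only [hρ₀] at hCm hCe
  simp only [hac_def, hθc_def, huc_def, hcls] at hCm hCe
  -- CC3 at `(N, s)`, ECT on the window
  have hTs := HTN N hNT s hsI
  have HEN' : ∀ r' ∈ Icc s (s + w), ∫⁻ z, ENNReal.ofReal (((N : ℝ) + 1)⁻¹ * ∑ i : Fin (N + 1),
      Set.indicator {v : V3 | M₃ < ‖v‖} (fun v => ‖v‖ ^ 3) (((Φ N).flow r' z i).2)) ∂(localGibbsLaw σ a₀ u₀ θ₀ N (Φ N)) ≤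
      ENNReal.ofReal 1 := fun r' hr' => HEN N hNE r' ⟨hs0.trans hr'.1, hr'.2.trans hsw⟩
  -- THE CUBIC CHANNEL AT `(N, s)`, PAID BY THE TAIL ALONE: Gaussian moments ⇒ cubic tails `≤ e^{-c′(K₁−U′)}` above `K₁ − U′`
  have hTail : ∀ r' ∈ Icc s (s + w), ∫⁻ z, ENNReal.ofReal (((N : ℝ) + 1)⁻¹ * ∑ i : Fin (N + 1),
      Set.indicator {v : V3 | K₁ - U' < ‖v‖} (fun v => ‖v‖ ^ 3) (((Φ N).flow r' z i).2)) ∂(localGibbsLaw σ a₀ u₀ θ₀ N (Φ N)) ≤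
      ENNReal.ofReal (Real.exp (-(c' * (K₁ - U')))) := fun r' hr' =>
    ClampedTransferDockSeet.lintegral_cubicTail_le_of_expMoment (localGibbsLaw σ a₀ u₀ θ₀ N (Φ N)) ((Φ N).flow r') hcG hc'0
      hCGm (HGN N hNG r' ⟨hs0.trans hr'.1, hr'.2.trans hsw⟩) hK₁T
  obtain ⟨-, -, -, hθpos_s, hθle_s, hule_s, hble_s, -⟩ := hslab s hsI
  have hCr0 : 0 ≤ Cρ * Real.exp (-(c' * K₁)) := by positivity
  have hQ' := @tailRate_cubicTailWindow σ N (Φ N) a₀ θ₀ u₀ θ u G K₁ U' Bb' θM' _ _ s w hσ hσ2 ha hθ hu ha0 hθ0 hK₁1 h2U hBb'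
    hθM' hCr0 (Real.exp_pos _).le hw0.le hule_s hble_s hθle_s (fun x => (hθpos_s x).le) (hRem1 s hsI) (hRem2 s hsI) hTail
  obtain ⟨Q, hQ⟩ : ∃ Q : ℝ, Q = w * ((N : ℝ) + 1) * S := ⟨_, rfl⟩
  have hQ0 : 0 ≤ Q := hQ ▸ by positivity
  have hQe : w * ((N : ℝ) + 1) * (8 * Bb' * (1 + 5 * θM' + Cρ * Real.exp (-(c' * K₁))) * Real.exp (-(c' * (K₁ - U'))) +
      Bb' * K₁ * (Cρ * Real.exp (-(c' * K₁)))) ≤ w * ((N : ℝ) + 1) * (ε' / 10) + Q := by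
    have hwN : 0 ≤ w * ((N : ℝ) + 1) := by positivity
    have hCr1 : Cρ * Real.exp (-(c' * K₁)) ≤ Cρ :=
      mul_le_of_le_one_right hCρ0 (Real.exp_le_one_iff.2 (neg_nonpos.2 (mul_nonneg hc'0.le hK₁0)))
    have h1 : 8 * Bb' * (1 + 5 * θM' + Cρ * Real.exp (-(c' * K₁))) * Real.exp (-(c' * (K₁ - U'))) ≤
        CT * Real.exp (-(c' * (K₁ - U'))) := by
      rw [hCT]
      refine mul_le_mul_of_nonneg_right ?_ (Real.exp_pos _).le
      gcongr
    have h2 := mul_le_mul_of_nonneg_left (add_le_add h1 (le_refl (Bb' * K₁ * (Cρ * Real.exp (-(c' * K₁)))))) hwN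
    have h3 : 0 ≤ w * ((N : ℝ) + 1) * (ε' / 10) := by positivity
    rw [hQ, hS]
    exact h2.trans (le_add_of_nonneg_left h3)
  have hQs := hQ'.trans (ENNReal.ofReal_le_ofReal hQe)
  -- Lipschitz constants of the test functions at `s`, continuity and bound of the cut-off profile at `s`
  have hLipm : ∀ (k : Fin 3) (x y : T3), |u s x k / θ s x - u s y k / θ s y| ≤ Cfz * Torus.euclidDist x y :=
    fun k x y => ((HFZ s hsI s hsI x 0).2.2.2.2.1) k y
  have hLipe : ∀ x y : T3, |(-(θ s x)⁻¹) - (-(θ s y)⁻¹)| ≤ Cfz * Torus.euclidDist x y :=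
    fun x y => ((HFZ s hsI s hsI x 0).2.2.2.2.2) y
  have hGs : Continuous (G s) := hGc.comp_continuous (continuous_const.prodMk continuous_id) fun y => ⟨hsI, mem_univ _⟩
  have hCGs : ∀ y : T3 × ℝ, 0 ≤ y.2 → |G s y| ≤ CG' := fun y hy => hCG'b s hsI y hy
  have hsmall : Cfz * w * (40 * (2 * (max M₃ 0) ^ 3 + 6 + V)) ≤ ε' := by
    have h : Cfz * τ * (40 * (2 * (max M₃ 0) ^ 3 + 6 + V)) * ((N : ℝ) + 1) ^ (-(1 / 3 : ℝ)) ≤ ε' := Hsm N hNsm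
    calc _ = Cfz * τ * (40 * (2 * (max M₃ 0) ^ 3 + 6 + V)) * ((N : ℝ) + 1) ^ (-(1 / 3 : ℝ)) := by rw [hw_def]; ring
      _ ≤ ε' := h
  -- THE ONE-WINDOW ESTIMATE WITH SLACK (`stub_windowEstimateRate`; all implicit arguments given explicitly)
  have hWE' := @hWE σ T η₁ τ t s w V Cfz Cfz CG' β ε' ε₁ ε₃ M₃ Q N (Φ N) ρ θ u F Rf G a₀ θ₀ u₀
    ha hθ hu ha0 hθ0 hE hσ hσ2 hη₁ hF hZF hRfF hg1 hasm' hapos' ht hs0 hw0 hsw hτ0 hw_def hV0 hCfz0 hCfz0 hLipm hLipe hGs hCGs HFZ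
    hβ0 hε'0 hε'1 hε₁ hε₃ hQ0 hsmall hKs hCm hCe hTs hQs HEN' hStrI hColI
  -- the a-priori bound: the running supremum is a supremum
  obtain ⟨Bap, hBap⟩ := EntropyClockDock.ledgerAprioriBound r Rf hr hbd hcont a₀ θ₀ u₀ ha hθ hu ha0 hθ0 σ hσ hσ2 T ρ θ u hE t ht
    hgr N (Φ N)
  have hswI : Icc 0 (s + w) ⊆ Icc 0 t := Icc_subset_Icc_right hsw
  have hbdd : BddAbove ((fun s' => (klDiv ((Φ N).lawAt (localGibbsLaw σ a₀ u₀ θ₀ N (Φ N)) s')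
      (localGibbsLaw σ (fun x => ρ s' x * Rf (σ ^ 3 * ρ s' x)) (u s') (θ s') N (Φ N))).toReal) '' Icc 0 (s + w)) := by
    refine ⟨max Bap 0, ?_⟩
    rintro _ ⟨s', hs', rfl⟩
    exact ENNReal.toReal_le_of_le_ofReal (le_max_right _ _) ((hBap s' (hswI hs')).trans (ENNReal.ofReal_le_ofReal (le_max_left _ _)))
  have hHs_le : (klDiv ((Φ N).lawAt (localGibbsLaw σ a₀ u₀ θ₀ N (Φ N)) s)
      (localGibbsLaw σ (fun x => ρ s x * Rf (σ ^ 3 * ρ s x)) (u s) (θ s) N (Φ N))).toReal ≤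
      sSup ((fun s' => (klDiv ((Φ N).lawAt (localGibbsLaw σ a₀ u₀ θ₀ N (Φ N)) s')
        (localGibbsLaw σ (fun x => ρ s' x * Rf (σ ^ 3 * ρ s' x)) (u s') (θ s') N (Φ N))).toReal) '' Icc 0 (s + w)) :=
    le_csSup hbdd ⟨s, ⟨hs0, hsw'⟩, rfl⟩
  exact ledger_step' hbal hWE' hQ hHs_le (by positivity) (by positivity) hε'ε

end Summit.AtomisticToContinuum.HydrodynamicLimit.Theorems.TransferEntropyClockTailRateWindowClause

end
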